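import Mathlib
import Summits.Ventures.PercRepro2.HalfLDegTwoMarks
import Summits.Ventures.PercRepro2.PendantA3Gaux
import Summits.Ventures.PercRepro2.PendantA3RootHCov
import Summits.Ventures.PercRepro2.PendantA3BAtt
import Summits.Ventures.PercRepro2.TypedPendantA3AtOWeighted

/-!
# (HCOV) for `a₃` of degree at most two touching only marks (blind cell PercRepro2, night-1 g37)

`HCov_update_zero_pendant`: at a pendant edge `f` of `a₃`, (HCOV) holds at `p[f ↦ 0]` (the isolated-`a₃`
value `Gc⁰ = 2Q[S(bL,oH) + S(bH,oL)] ≥ 0`, `PendantA3.gcPoly_zero_eq`); `HCov_degOneMark`: `a₃` a leaf at a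
mark `x ∈ {o, b, a₁, a₂}` — mine-2's weighted pendant rules `TypedRed.HCov_pendant_a3_at_o`,
`HCov_pendant_a3_at_a₁`, `HCov_pendant_a3_at_a₂` (closing the `p[f ↦ 0]` hypothesis) and
`SideBound.HCov_pendant_a3_at_b_unconditional`; with `HCov_degTwoMarks` (degree two) and
`A3Inactive.HCov_of_isolated_a3` (degree zero) the table «`a₃` of degree ≤ 2 touching only marks» is closed
for (HCOV) in the kernel.
-/

namespace Summit.Ventures.PercRepro2

namespace HalfLTwoMark

open CaseOne CovForm PendantA3

section Pendant

variable {V : Type*} {E : Type*} [Fintype E] [DecidableEq E] [Fintype V] [DecidableEq V]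
  {R : Type*} [Field R] [LinearOrder R] [IsStrictOrderedRing R]

/-- **(HCOV) at `p[f ↦ 0]` for a pendant edge `f` of `a₃`**: the isolated value `Gc⁰ ≥ 0`. -/
theorem HCov_update_zero_pendant (p : E → R) (hp : IsProbVec p) {ends : E → Sym2 V} {f : E}
    {o a₁ a₂ a₃ b u : V} (hf : ends f = s(a₃, u)) (hleaf : ∀ e, a₃ ∈ ends e → e = f)
    (h3u : a₃ ≠ u) (h13 : a₁ ≠ a₃) (h23 : a₂ ≠ a₃) (ho3 : o ≠ a₃) (hb3 : b ≠ a₃) :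
    HCov (Function.update p f 0) ends o a₁ a₂ a₃ b := by
  obtain ⟨hQ0, hD0, hDo0, hEQbo0, hEQb3_0, hEQb3o0, hEQo0, hEQ3_0, hEQ3o0, hPDb0, hPDbo0, hgap0⟩ :=
    pins_zero_pendant p hf hleaf h3u h13 h23 ho3 hb3
  unfold HCov
  rw [EdgeLine.Gc_eq_GcPoly, hQ0, hD0, hDo0, hEQbo0, hEQb3_0, hEQb3o0, hEQo0, hEQ3_0, hEQ3o0, hPDb0,
    hPDbo0, hgap0, gcPoly_zero_eq]
  exact gcZero_nonneg p hp ends o a₁ a₂ b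

/-- **(HCOV) for `a₃` a leaf at a mark `x ∈ {o, b, a₁, a₂}`**, every weight of the leaf edge. -/
theorem HCov_degOneMark (p : E → R) (hp : IsProbVec p) (ends : E → Sym2 V) (o a₁ a₂ a₃ b : V)
    (f : E) (x : V) (hx : x ∈ ({o, b, a₁, a₂} : Finset V)) (hf : ends f = s(x, a₃))
    (hleaf : ∀ e, a₃ ∈ ends e → e = f) (ho3 : o ≠ a₃) (hb3 : b ≠ a₃) (h13 : a₁ ≠ a₃)
    (h23 : a₂ ≠ a₃) : HCov p ends o a₁ a₂ a₃ b := by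
  simp only [Finset.mem_insert, Finset.mem_singleton] at hx
  have hf' : ends f = s(a₃, x) := by rw [hf, Sym2.eq_swap]
  rcases hx with rfl | rfl | rfl | rfl
  · exact TypedRed.HCov_pendant_a3_at_o ends x a₁ a₂ a₃ b hf' hleaf ho3.symm h13.symm h23.symm hb3.symm
      p (hp.le_one f) (HCov_update_zero_pendant p hp hf' hleaf ho3.symm h13 h23 ho3 hb3)
  · exact SideBound.HCov_pendant_a3_at_b_unconditional p hp ends hf' hleaf hb3.symm h13.symm h23.symm ho3
  · exact TypedRed.HCov_pendant_a3_at_a1 ends o x a₂ a₃ b hf' hleaf h13.symm ho3.symm h23.symm hb3.symm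
      p hp (HCov_update_zero_pendant p hp hf' hleaf h13.symm h13 h23 ho3 hb3)
  · exact TypedRed.HCov_pendant_a3_at_a2 ends o a₁ x a₃ b hf' hleaf h23.symm ho3.symm h13.symm hb3.symm
      p hp (HCov_update_zero_pendant p hp hf' hleaf h23.symm h13 h23 ho3 hb3)

end Pendant

end HalfLTwoMark

end Summit.Ventures.PercRepro2
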